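import Summits.QuantumFields.BalabanUV.T4Continuum.Support.NE3ProjectedLandauProjection
import Summits.QuantumFields.BalabanUV.T4Continuum.Support.NE3FrameFreeSliceUnique
import Summits.QuantumFields.BalabanUV.T4Continuum.Support.NE3FrameFreeDecompositionPrep
import HarnessLib

/-!
# T⁴ programme, node NE3 — row E-MLw-(w4)-P, sub-row Φ6 (flat), PROJECTED-LANDAU variant, file 2: THE DECOMPOSITION
# `ker (Tcoarse L)^[k] ∩ {skew, periodic} = dPot Ξ₀ ⊕ T_pt(1)` (existence of the corner-trivial gauge representative with
# VANISHING divergence off the block corners, and the trivial intersection)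

NE3 (node U1b) formalisation swarm `b2b-balaban-t4-ne3-formalise-*`, leaf seat `b2b-balaban-t4-ne3-formalise-leaf-01`
(gen 5), row **Φ6** of rulings ρ-g21-3 ∕ ρ-g21-4 (W2)(W4); division with leaf-02-g5 («T_pt MINE», journal ≈15:58Z).  File 1 =
`NE3ProjectedLandauProjection` (abstract `E`-valued projection and the vanishing of the divergence off corners); the frame-free
twin `T_♮` is `NE3FrameFreeSliceUnique` (this seat) + leaf-02-g5's `NE3FrameFreeDecomposition*` (whose `Prep` file this one imports
for the skewness of `flatDiv` and `dPot`).

WHAT.  `T_pt(1)` (ρ-g21-2 (V4): «PROJECTED (corner) Landau `D^* Y (x) = 0 for x ∉ L^k•ℤ^d`», the ℓ²-orthogonal complement of the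
CORNER-TRIVIAL gauge orbit `dPot Ξ₀` inside the flat k-fold tangent space; ρ-g21-4 (W2): the chart's min-norm slice).  THIS FILE
(0 sorry, 0 def):
§1 matrix bookkeeping (`flatDiv`∕`dPot` in entries, additivity, `skewP` against the lattice Laplacian; skewness of `flatDiv`∕`dPot`
   from leaf-02-g5's `NE3FrameFreeDecompositionPrep` BY NAME);
§2 **`exists_cornerGauge_projLandau`** — `L, N, k ≥ 1`; every skew, `(N·L^k)`-periodic `Y` with `TangentIter L (k−1) flatCfg Y` has a
   `𝔲(N)`-valued, periodic, CORNER-TRIVIAL `ξ` such that `Z = Y + dPot ξ` is skew, periodic, TANGENT (`TangentIter L (k−1) flatCfg Z`)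
   and `flatDiv Z ((L^k)•z + v) = 0` for all `z` and `v ∈ [0,L^k)^d ∖ {0}` (file 1 entrywise with `E = ℂ`, re-skewed by `skewP`;
   tangency by Φ1a `iterate_Tcoarse_add_dPot_of_corner`);
§3 **`dPot_eq_zero_of_projLandau`** — the TRIVIAL INTERSECTION: a corner-trivial periodic `ξ` whose coboundary has vanishing
   divergence off the corners has `dPot ξ = 0` (`Σ‖dPot ξ‖²_HS = −Σ⟨flatDiv (dPot ξ), ξ⟩_HS`, `NE3FrameFreeSliceUnique.sum_nhsNormSq_dPot_eq`:
   at corners `ξ = 0`, elsewhere the divergence is `0`).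

HONEST FRAMING.  Flat finite-dimensional linear algebra on our lattice objects; nothing about Bałaban's minimisers; (P♮), (ML_w) at
W ≠ 1, T-E_w and **NE3 are NOT proved**; spine PROVED 0∕9; finite T⁴ rung (B)+1 — NOT infinite volume, NOT mass gap, NOT
`BetaPertH`, NOT Clay.  PLACEMENT: `Summits/QuantumFields/BalabanUV/`.  HONEST DEPENDENCY (cell page 1): continuum YM on T⁴ ⇐
BetaPertH ∧ nine spine estimates (0/9 proved); BetaPertH ⇐ (D1) ∧ (D4) ∧ CAP+tail; G-an2-4 gates asym, D1 and NE2/3/4.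
-/

set_option autoImplicit false

open scoped BigOperators Matrix.Norms.L2Operator
open Finset

namespace Summit.QuantumFields.BalabanUV.T4Continuum.NE3ProjectedLandauRepr

open Literature.MathematicalPhysics.QuantumFieldTheory.Balaban1983to89
open B7Prop1Explicit MatrixNorms
open T4AveragingDeficitWall (IsSkewDir)
open T4AveragingDeficitWallBoundary (periodBox mem_periodBox)
open AveragingDeficitPeriodicCounting (IsPeriodicDir)
open AveragingDeficitMultiLevelPrep (TangentIter)
open AveragingDeficitTorusChart (skewP skewP_mem skewP_of_mem)
open MinimalActionWitness (flatCfg)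
open SmoothRefineNeutral (Tcoarse)
open NE3TangentNoGoWords (dPot)
open NE3CoercivityScaling (flatDiv)
open NE3TangentFlatStructure (dPot_add_period tangentIter_flat_iff_iterate)
open NE3FramePotGauge (iterate_Tcoarse_add_dPot_of_corner)
open NE3BlockLineAverage (sum_periodBox_blocks)
open NE3CovariantCalculus (hsR)
open NE3LandauOrbit (eq_zero_of_nhsNormSq_eq_zero hsR_zero_left hsR_zero_right)
open NE3TorusProjection (cobd)
open NE3ProjectedLandauProjection (exists_projLandau_repr zero_mem_periodBox)
open NE3FrameFreeSliceUnique (sum_nhsNormSq_dPot_eq eq_zero_of_periodic_of_box)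
open NE3FrameFreeDecompositionPrep (flatDiv_mem_skewAdjoint isSkewDir_dPot)

noncomputable section

variable {d : ℕ} {n : Type*} [Fintype n] [DecidableEq n]

/-! ## §1 Matrix bookkeeping -/

omit [Fintype n] [DecidableEq n] in
/-- `flatDiv` read in an entry. [folklore] -/
theorem flatDiv_apply (X : Site d → Fin d → Matrix n n ℂ) (x : Site d) (i j : n) :
    flatDiv X x i j = ∑ μ : Fin d, (X x μ i j - X (x - e μ) μ i j) := by
  simp only [flatDiv, Matrix.sum_apply, Matrix.sub_apply]

/-- `dPot` read in an entry is the scalar coboundary `cobd` of the entry. [folklore] -/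
theorem dPot_apply (ξ : Site d → Matrix n n ℂ) (x : Site d) (μ : Fin d) (i j : n) :
    dPot ξ x μ i j = cobd (fun y => ξ y i j) x μ := by
  simp only [dPot, cobd, Matrix.sub_apply]

omit [Fintype n] [DecidableEq n] in
/-- `flatDiv` is additive. [folklore] -/
theorem flatDiv_add (A B : Site d → Fin d → Matrix n n ℂ) (x : Site d) :
    flatDiv (fun y μ => A y μ + B y μ) x = flatDiv A x + flatDiv B x := by
  simp only [flatDiv, ← sum_add_distrib]
  exact sum_congr rfl fun μ _ => by abel

/-- **THE SKEW PROJECTION COMMUTES WITH THE LATTICE LAPLACIAN**: `flatDiv (dPot (skewP ∘ ξ)) x = skewP (flatDiv (dPot ξ) x)`. [folklore] -/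
theorem flatDiv_dPot_skewP (ξ : Site d → Matrix n n ℂ) (x : Site d) :
    flatDiv (dPot fun y => skewP (ξ y)) x = skewP (flatDiv (dPot ξ) x) := by
  simp only [flatDiv, dPot, map_sum, map_sub]

/-! ## §2 Existence: the corner-trivial gauge representative with vanishing divergence off the corners -/

/-- **EVERY FLAT k-FOLD TANGENT DIRECTION IS CORNER-TRIVIALLY GAUGE-EQUIVALENT TO A PROJECTED-LANDAU ONE.**  `L, N, k ≥ 1`; `Y`
skew, `(N·L^k)`-periodic, `TangentIter L (k−1) flatCfg Y` ⇒ there is a `𝔲(N)`-valued, `(N·L^k)`-periodic site field `ξ` vanishing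
on `(L^k)•ℤ^d` such that `Z = Y + dPot ξ` is skew, periodic, tangent, and `flatDiv Z ((L^k)•z + v) = 0` for every block `z` and
every offset `v ∈ [0,L^k)^d ∖ {0}` — the flat `T_pt(1)` representative (ρ-g21-2 (V4), ρ-g21-4 (W2)). [folklore] -/
theorem exists_cornerGauge_projLandau {L N k : ℕ} (hL : 1 ≤ L) (hN : 1 ≤ N) (hk : 1 ≤ k)
    {Y : Site d → Fin d → Matrix n n ℂ} (hYs : IsSkewDir Y)
    (hYP : IsPeriodicDir Y ((N * L ^ k : ℕ) : ℤ)) (hYT : TangentIter L (k - 1) (flatCfg (d := d) (n := n)) Y) :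
    ∃ ξ : Site d → Matrix n n ℂ, (∀ x, ξ x ∈ skewAdjoint (Matrix n n ℂ))
      ∧ (∀ (x : Site d) (τ : Fin d), ξ (x + ((N * L ^ k : ℕ) : ℤ) • e τ) = ξ x)
      ∧ (∀ w : Site d, ξ (((L ^ k : ℕ) : ℤ) • w) = 0)
      ∧ IsSkewDir (fun x μ => Y x μ + dPot ξ x μ)
      ∧ IsPeriodicDir (fun x μ => Y x μ + dPot ξ x μ) ((N * L ^ k : ℕ) : ℤ)
      ∧ TangentIter L (k - 1) (flatCfg (d := d) (n := n)) (fun x μ => Y x μ + dPot ξ x μ)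
      ∧ ∀ (z v : Site d), v ∈ periodBox (d := d) (L ^ k) → v ≠ 0 →
          flatDiv (fun x μ => Y x μ + dPot ξ x μ) (((L ^ k : ℕ) : ℤ) • z + v) = 0 := by
  set M : ℕ := L ^ k with hMdef
  have hM : 1 ≤ M := Nat.one_le_pow _ _ hL
  have hcast : ((L : ℤ) ^ k) = (M : ℤ) := by rw [hMdef]; push_cast; ring
  have hPer' : ((M * N : ℕ) : ℤ) = ((N * M : ℕ) : ℤ) := by push_cast; ring
  have hkk : k - 1 + 1 = k := Nat.sub_add_cancel hk
  have hT : (Tcoarse L)^[k] Y = 0 := by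
    have h := (tangentIter_flat_iff_iterate hL (k - 1) Y).mp hYT
    rwa [hkk] at h
  -- the projected-Landau step, entrywise with `E = ℂ`
  have hent : ∀ i j : n, ∃ ζ : Site d → ℂ,
      (∀ (x : Site d) (τ : Fin d), ζ (x + ((M * N : ℕ) : ℤ) • e τ) = ζ x) ∧
      (∀ w : Site d, ζ ((M : ℤ) • w) = 0) ∧
      ∀ (z v : Site d), v ∈ periodBox (d := d) M → v ≠ 0 →
        ∑ κ : Fin d, ((Y ((M : ℤ) • z + v) κ i j + cobd ζ ((M : ℤ) • z + v) κ)
          - (Y ((M : ℤ) • z + v - e κ) κ i j + cobd ζ ((M : ℤ) • z + v - e κ) κ)) = 0 := by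
    intro i j
    refine exists_projLandau_repr (E := ℂ) hM hN (fun x μ => Y x μ i j) ?_
    intro x τ μ
    rw [hPer']; exact congrArg (fun A : Matrix n n ℂ => A i j) (hYP x τ μ)
  choose ζ hζP hζc hζdiv using hent
  set ξ₂ : Site d → Matrix n n ℂ := fun x => Matrix.of fun i j => ζ i j x with hξ₂
  set ξ : Site d → Matrix n n ℂ := fun x => skewP (ξ₂ x) with hξ
  have hξ₂P : ∀ (x : Site d) (τ : Fin d), ξ₂ (x + ((N * M : ℕ) : ℤ) • e τ) = ξ₂ x := by
    intro x τ; ext i j; simp only [hξ₂, Matrix.of_apply]; rw [← hPer']; exact hζP i j x τ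
  have hξ₂c : ∀ w : Site d, ξ₂ ((M : ℤ) • w) = 0 := by
    intro w; ext i j; simp only [hξ₂, Matrix.of_apply, Matrix.zero_apply]; exact hζc i j w
  have hξP : ∀ (x : Site d) (τ : Fin d), ξ (x + ((N * M : ℕ) : ℤ) • e τ) = ξ x := by
    intro x τ; simp only [hξ, hξ₂P]
  have hξc : ∀ w : Site d, ξ ((M : ℤ) • w) = 0 := by
    intro w; simp only [hξ, hξ₂c, map_zero]
  have hξc' : ∀ w : Site d, ξ (((L : ℤ) ^ k) • w) = 0 := by
    intro w; rw [hcast]; exact hξc w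
  have hξs : ∀ x, ξ x ∈ skewAdjoint (Matrix n n ℂ) := fun x => skewP_mem _
  -- the divergence of `Y + dPot ξ₂` vanishes off the corners (entrywise data collected)
  have hdiv₂ : ∀ (z v : Site d), v ∈ periodBox (d := d) M → v ≠ 0 →
      flatDiv (fun x μ => Y x μ + dPot ξ₂ x μ) ((M : ℤ) • z + v) = 0 := by
    intro z v hv hv0
    ext i j
    rw [flatDiv_apply, Matrix.zero_apply]
    have h := hζdiv i j z v hv hv0
    simp only [Matrix.add_apply, dPot_apply, hξ₂, Matrix.of_apply] at h ⊢
    convert h using 1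
  refine ⟨ξ, hξs, hξP, fun w => by rw [← hcast]; exact hξc' w, ?_, ?_, ?_, ?_⟩
  · exact fun x μ => (skewAdjoint _).add_mem (hYs x μ) (isSkewDir_dPot hξs x μ)
  · intro x τ μ
    show Y (x + ((N * L ^ k : ℕ) : ℤ) • e τ) μ + dPot ξ (x + ((N * L ^ k : ℕ) : ℤ) • e τ) μ = Y x μ + dPot ξ x μ
    rw [← hMdef, hYP x τ μ, dPot_add_period hξP x τ μ]
  · have hZT : (Tcoarse L)^[k - 1 + 1] (fun x μ => Y x μ + dPot ξ x μ) = 0 := by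
      rw [hkk, iterate_Tcoarse_add_dPot_of_corner hL k Y hξc', hT]
    exact (tangentIter_flat_iff_iterate hL (k - 1) _).mpr hZT
  · intro z v hv hv0
    have hM' : (((L ^ k : ℕ) : ℤ)) = (M : ℤ) := by rw [hMdef]
    have hvM : v ∈ periodBox (d := d) M := by simpa [hMdef] using hv
    rw [hM', flatDiv_add, hξ, flatDiv_dPot_skewP, ← skewP_of_mem (flatDiv_mem_skewAdjoint hYs _), ← map_add,
      ← flatDiv_add, hdiv₂ z v hvM hv0, map_zero]

/-! ## §3 The trivial intersection `dPot Ξ₀ ∩ T_pt(1) = {0}` -/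

/-- **A CORNER-TRIVIAL GAUGE DIRECTION WITH VANISHING DIVERGENCE OFF THE CORNERS IS ZERO**: `L, N ≥ 1`; `ξ` `(N·L^k)`-periodic,
`ξ = 0` on `(L^k)•ℤ^d`, and `flatDiv (dPot ξ) ((L^k)•z + v) = 0` for every block `z` and `v ∈ [0,L^k)^d ∖ {0}` ⇒ `dPot ξ = 0`
(with §2: `ker (Tcoarse L)^[k] ∩ {skew, periodic} = dPot Ξ₀ ⊕ T_pt(1)`). [folklore] -/
theorem dPot_eq_zero_of_projLandau {L N k : ℕ} (hL : 1 ≤ L) (hN : 1 ≤ N) {ξ : Site d → Matrix n n ℂ}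
    (hξP : ∀ (x : Site d) (τ : Fin d), ξ (x + ((N * L ^ k : ℕ) : ℤ) • e τ) = ξ x)
    (hξc : ∀ w : Site d, ξ (((L ^ k : ℕ) : ℤ) • w) = 0)
    (hdiv : ∀ (z v : Site d), v ∈ periodBox (d := d) (L ^ k) → v ≠ 0 →
      flatDiv (dPot ξ) (((L ^ k : ℕ) : ℤ) • z + v) = 0) :
    dPot ξ = 0 := by
  set M : ℕ := L ^ k with hMdef
  have hM : 1 ≤ M := Nat.one_le_pow _ _ hL
  have hP : 1 ≤ N * M := Nat.mul_pos (by omega) (by omega)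
  have h0 : (0 : Site d) ∈ periodBox (d := d) M := zero_mem_periodBox hM
  have hS := sum_nhsNormSq_dPot_eq (d := d) (n := n) hP hξP
  have hblock : ∀ z : Site d, ∑ v ∈ periodBox (d := d) M, hsR (flatDiv (dPot ξ) ((M : ℤ) • z + v)) (ξ ((M : ℤ) • z + v)) = 0 := by
    intro z
    refine Finset.sum_eq_zero fun v hv => ?_
    by_cases hv0 : v = 0
    · subst hv0
      have : ξ ((M : ℤ) • z + 0) = 0 := by rw [add_zero]; exact_mod_cast hξc z
      rw [this, hsR_zero_right]
    · have h := hdiv z v (by simpa [hMdef] using hv) hv0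
      have hM' : (((L ^ k : ℕ) : ℤ)) = (M : ℤ) := by rw [hMdef]
      rw [hM'] at h
      rw [h, hsR_zero_left]
  have hR : ∑ x ∈ periodBox (d := d) (N * M), hsR (flatDiv (dPot ξ) x) (ξ x) = 0 := by
    rw [show N * M = M * N from Nat.mul_comm _ _, ← sum_periodBox_blocks M N hM (fun x => hsR (flatDiv (dPot ξ) x) (ξ x))]
    exact Finset.sum_eq_zero fun z _ => hblock z
  rw [hR, neg_zero] at hS
  have hx : ∀ x ∈ periodBox (d := d) (N * M), ∀ μ : Fin d, dPot ξ x μ = 0 := by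
    intro x hx μ
    have h1 := (Finset.sum_eq_zero_iff_of_nonneg fun y _ =>
      Finset.sum_nonneg fun ν _ => nhsNormSq_nonneg (dPot ξ y ν)).1 hS x hx
    have h2 := (Finset.sum_eq_zero_iff_of_nonneg fun ν _ => nhsNormSq_nonneg (dPot ξ x ν)).1 h1 μ (Finset.mem_univ μ)
    exact eq_zero_of_nhsNormSq_eq_zero h2
  funext x μ
  have hper : ∀ (y : Site d) (τ : Fin d), (fun w => dPot ξ w μ) (y + ((N * M : ℕ) : ℤ) • e τ) = (fun w => dPot ξ w μ) y :=
    fun y τ => dPot_add_period hξP y τ μ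
  exact eq_zero_of_periodic_of_box hP hper (fun y hy => hx y hy μ) x

end

end Summit.QuantumFields.BalabanUV.T4Continuum.NE3ProjectedLandauRepr
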